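import Mathlib.Analysis.Calculus.Deriv.MeanValue
import Literature.MathematicalPhysics.QuantumFieldTheory.Balaban1983to89.T4ShellMeasure
import Summits.QuantumFields.YangMills.Theorems.BalabanUVNodesN21GaussianMillsRatio

/-!
# N21 (NE7c) · the `√(2 log n)` density bound for the law of the maximum of `n` independent standard Gaussians

R134 seat pub-ymgap-dag-n21-d (g7), node N21 = NE7c (single-run shell-weight bound, NOT PRINTED in [Bałaban 1983–89],
NOT proved), lane K3⁵ `SpineGivenEndpointR13SepCoP` (stmt-QuantumFields-20296, `--kind proof --supports … --as helper`).
Part 2 of 2; part 1 = `BalabanUVNodesN21GaussianMillsRatio` (`Φ′ = φ`, Gordon's Mills inequality, `maxDensity_le`).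

WHAT THIS FILE IS.  The lens memo `ym-lens-BalabanUVNodes-nearmiss/LENS-nearmiss.md` v12.0, Card 36 («the
Lévy-concentration dictionary») observes that the ONE level-growing parameter of the (M1) wall
(`T4ShellMeasure.SlotAntiConcentration` for a block-sup statistic over `n_j ~ (M₁L^j)⁴` tested fine plaquettes) is the
NUMBER of tested variables, and that anti-concentration of SUPREMA is LOGARITHMIC in that number (Chernozhukov–
Chetverikov–Kato, Ann. Stat. 42 (2014) Thm 2.1 [corpus: paper:arxiv-1303.7152 p.6]; PTRF 162 (2015) Thm 3), whereas the
union bound (`slotAntiConcentration_iSup`, lens Sketch-g12 §M, N60) is LINEAR.  This file PROVES the comparison-model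
half of that mechanism in the kernel, for the textbook case of `n` INDEPENDENT STANDARD Gaussians: under
`Measure.pi (fun _ : Fin n => gaussianReal 0 1)` the maximum coordinate has `P(max ≤ z) = Φ(z)^n`, its distribution
function is `(√(2 log n) + 4)`-Lipschitz (mean value theorem on part 1's `maxDensity_le`), hence ★★ the law of the
maximum has the tree's `T4ShellMeasure.DensityBound` with constant `√(2 log n) + 4` — against the union-bound constant
`n/√(2π)` from `T4ShellMeasure.densityBound_gaussianReal` (the tree's `n = 1` case, CITED) — and therefore the lens's
Lévy-concentration shape `P(|max − x₀| ≤ ε) ≤ (√(2 log n) + 4)·2ε·P(univ)` (Sketch-nearmiss-g12 §C's `hlevy`) and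
`SlotAntiConcentration μ max θ ρ ((√(2 log n) + 4)·θ)` for `θ, ρ ≥ 0`.

HONEST FRAMING.  [textbook] probability, 0 def, 0 sorry; nothing of Bałaban's asserted.  The (2.18) fibre law of the
wall is NEITHER Gaussian NOR a product (lens KT-36a∕b stand: the comparison∕coupling step and the `p`-uniformity of the
variances are NOT in the tree); this is the number that makes a LEVEL-UNIFORM `D` in `T4ShellMeasureLevels.LevelLedger`
plausible (`√(log n_j) ~ √j` against `ρ_j` geometric), not an estimate on Bałaban's measure.  NE7c NOT PRINTED ∕ NOT
proved; N21 NOT discharged; counts unmoved (typed 28∕28 · discharged 5∕27); count-neutral; one finite 𝕋⁴ at fixed ε —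
nothing about ℝ⁴ ∕ OS ∕ mass gap ∕ Clay.
-/

open MeasureTheory ProbabilityTheory Set Filter Topology
open scoped ENNReal NNReal

namespace Summit.QuantumFields.YangMills.Theorems.N21GaussianSupDensityBound

open Summit.QuantumFields.YangMills.Theorems.N21GaussianMillsRatio

/-! ## §4 The law of the maximum under `Measure.pi (fun _ : Fin n => gaussianReal 0 1)`: `DensityBound`, Lévy concentration, (M1) -/

section Max

variable {n : ℕ} [NeZero n]

/-- the maximum coordinate is measurable. [folklore] -/
theorem measurable_sup' :
    Measurable (fun ω : Fin n → ℝ => Finset.univ.sup' Finset.univ_nonempty ω) := by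
  have h : (fun ω : Fin n → ℝ => Finset.univ.sup' Finset.univ_nonempty ω)
      = Finset.univ.sup' Finset.univ_nonempty (fun (i : Fin n) (ω : Fin n → ℝ) => ω i) := by
    funext ω
    rw [Finset.sup'_apply]
  rw [h]
  exact Finset.measurable_sup' _ fun i _ => measurable_pi_apply i

/-- `{max ≤ z}` is the box `∏ (−∞, z]`. [folklore] -/
theorem setOf_sup'_le_eq_pi (z : ℝ) :
    {ω : Fin n → ℝ | Finset.univ.sup' Finset.univ_nonempty ω ≤ z} = Set.pi univ fun _ => Iic z := by
  ext ω
  simp [Finset.sup'_le_iff, Pi.le_def]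

/-- **`P(max ≤ z) = Φ(z)^n`** for `n` independent standard Gaussians. [textbook] -/
theorem pi_gaussianReal_real_sup'_le (z : ℝ) :
    (Measure.pi fun _ : Fin n => gaussianReal 0 1).real
        {ω : Fin n → ℝ | Finset.univ.sup' Finset.univ_nonempty ω ≤ z}
      = cdf (gaussianReal 0 1) z ^ n := by
  rw [setOf_sup'_le_eq_pi, measureReal_def, Measure.pi_pi]
  simp only [Finset.prod_const, Finset.card_univ, Fintype.card_fin, ENNReal.toReal_pow]
  rw [← measureReal_def, ← cdf_eq_real]

/-- `P(a < max ≤ b) = Φ(b)^n − Φ(a)^n` (`a ≤ b`). [textbook] -/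
theorem pi_gaussianReal_real_sup'_mem_Ioc {a b : ℝ} (hab : a ≤ b) :
    (Measure.pi fun _ : Fin n => gaussianReal 0 1).real
        {ω : Fin n → ℝ | a < Finset.univ.sup' Finset.univ_nonempty ω ∧ Finset.univ.sup' Finset.univ_nonempty ω ≤ b}
      = cdf (gaussianReal 0 1) b ^ n - cdf (gaussianReal 0 1) a ^ n := by
  set μ := (Measure.pi fun _ : Fin n => gaussianReal 0 1) with hμ
  have hset : {ω : Fin n → ℝ | a < Finset.univ.sup' Finset.univ_nonempty ω ∧ Finset.univ.sup' Finset.univ_nonempty ω ≤ b}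
      = {ω : Fin n → ℝ | Finset.univ.sup' Finset.univ_nonempty ω ≤ b}
        \ {ω : Fin n → ℝ | Finset.univ.sup' Finset.univ_nonempty ω ≤ a} := by
    ext ω
    simp only [mem_setOf_eq, Set.mem_sdiff, not_le]
    tauto
  have hsub : {ω : Fin n → ℝ | Finset.univ.sup' Finset.univ_nonempty ω ≤ a}
      ⊆ {ω : Fin n → ℝ | Finset.univ.sup' Finset.univ_nonempty ω ≤ b} := fun ω hω => le_trans hω hab
  have hmeas : MeasurableSet {ω : Fin n → ℝ | Finset.univ.sup' Finset.univ_nonempty ω ≤ a} :=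
    measurable_sup' measurableSet_Iic
  rw [hset, measureReal_sdiff hsub hmeas, pi_gaussianReal_real_sup'_le, pi_gaussianReal_real_sup'_le]

/-- the distribution function of the maximum is `(√(2 log n) + 4)`-Lipschitz: `Φ(b)^n − Φ(a)^n ≤ (√(2 log n) + 4)(b − a)`
(mean value theorem with §1 `Φ′ = φ` and §3). [textbook] -/
theorem cdf_pow_sub_le {a b : ℝ} (hab : a ≤ b) :
    cdf (gaussianReal 0 1) b ^ n - cdf (gaussianReal 0 1) a ^ n ≤ (Real.sqrt (2 * Real.log n) + 4) * (b - a) := by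
  have hn : 1 ≤ n := NeZero.one_le
  have hderiv : ∀ x, HasDerivAt (fun z => cdf (gaussianReal 0 1) z ^ n)
      ((n : ℝ) * cdf (gaussianReal 0 1) x ^ (n - 1) * gaussianPDFReal 0 1 x) x := fun x =>
    (hasDerivAt_cdf_std x).pow n
  have hdiff : Differentiable ℝ fun z => cdf (gaussianReal 0 1) z ^ n := fun x => (hderiv x).differentiableAt
  have hbound : ∀ x, deriv (fun z => cdf (gaussianReal 0 1) z ^ n) x ≤ Real.sqrt (2 * Real.log n) + 4 := fun x => by
    rw [(hderiv x).deriv]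
    have := maxDensity_le hn x
    calc (n : ℝ) * cdf (gaussianReal 0 1) x ^ (n - 1) * gaussianPDFReal 0 1 x
        = (n : ℝ) * gaussianPDFReal 0 1 x * cdf (gaussianReal 0 1) x ^ (n - 1) := by ring
      _ ≤ Real.sqrt (2 * Real.log n) + 4 := this
  exact image_sub_le_mul_sub_of_deriv_le hdiff hbound hab

/-- **`DensityBound` FOR THE LAW OF THE MAXIMUM** (the tree's `T4ShellMeasure.DensityBound` currency): the law of
`max_{i<n} X_i`, `X_i` iid `N(0,1)`, gives every interval `[a, b]` mass at most `(√(2 log n) + 4)(b − a)` — against the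
union-bound constant `n/√(2π)` (`T4ShellMeasure.densityBound_gaussianReal`, the `n = 1` instance, summed over `i`). [textbook] -/
theorem densityBound_map_sup'_pi_gaussianReal :
    Literature.MathematicalPhysics.QuantumFieldTheory.Balaban1983to89.T4ShellMeasure.DensityBound
      ((Measure.pi fun _ : Fin n => gaussianReal 0 1).map
        fun ω : Fin n → ℝ => Finset.univ.sup' Finset.univ_nonempty ω)
      (Real.sqrt (2 * Real.log n) + 4) := by
  intro a b hab
  set μ := (Measure.pi fun _ : Fin n => gaussianReal 0 1) with hμ
  set S := Real.sqrt (2 * Real.log n) + 4 with hS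
  have hS0 : 0 ≤ S := by positivity
  rw [Measure.map_apply measurable_sup' measurableSet_Icc]
  -- for every η > 0: the preimage of [a, b] sits inside {a − η/S < max ≤ b}, of mass Φ(b)^n − Φ(a−η/S)^n ≤ S (b − a) + η
  refine ENNReal.le_of_forall_pos_le_add fun η hη _ => ?_
  have hη' : (0 : ℝ) < η := hη
  have hS1 : 0 < S := by positivity
  set δ : ℝ := (η : ℝ) / S with hδ
  have hδ0 : 0 < δ := div_pos hη' hS1
  have hsub : (fun ω : Fin n → ℝ => Finset.univ.sup' Finset.univ_nonempty ω) ⁻¹' Icc a b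
      ⊆ {ω : Fin n → ℝ | a - δ < Finset.univ.sup' Finset.univ_nonempty ω ∧ Finset.univ.sup' Finset.univ_nonempty ω ≤ b} := by
    intro ω hω
    simp only [mem_preimage, mem_Icc] at hω
    exact ⟨by linarith [hω.1], hω.2⟩
  have hSδ : S * (b - (a - δ)) = S * (b - a) + η := by
    rw [hδ]
    field_simp
    ring
  calc μ ((fun ω : Fin n → ℝ => Finset.univ.sup' Finset.univ_nonempty ω) ⁻¹' Icc a b)
      ≤ μ {ω : Fin n → ℝ | a - δ < Finset.univ.sup' Finset.univ_nonempty ω ∧ Finset.univ.sup' Finset.univ_nonempty ω ≤ b} :=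
        measure_mono hsub
    _ = ENNReal.ofReal (cdf (gaussianReal 0 1) b ^ n - cdf (gaussianReal 0 1) (a - δ) ^ n) := by
        rw [← pi_gaussianReal_real_sup'_mem_Ioc (by linarith), measureReal_def, ENNReal.ofReal_toReal (measure_ne_top _ _)]
    _ ≤ ENNReal.ofReal (S * (b - (a - δ))) := ENNReal.ofReal_le_ofReal (cdf_pow_sub_le (by linarith))
    _ = ENNReal.ofReal (S * (b - a)) + ENNReal.ofReal (η : ℝ) := by
        rw [hSδ, ENNReal.ofReal_add (by nlinarith) hη'.le]
    _ = ENNReal.ofReal (S * (b - a)) + η := by rw [ENNReal.ofReal_coe_nnreal]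

/-- **LÉVY CONCENTRATION OF THE MAXIMUM** (the lens's `hlevy` shape, Sketch-nearmiss-g12 §C): for every centre `x₀` and
radius `ε ≥ 0`, `P(|max − x₀| ≤ ε) ≤ (√(2 log n) + 4)·2ε · P(univ)`. [textbook] -/
theorem levyConcentration_sup'_pi_gaussianReal (x₀ : ℝ) {ε : ℝ} (hε : 0 ≤ ε) :
    (Measure.pi fun _ : Fin n => gaussianReal 0 1)
        {ω : Fin n → ℝ | |Finset.univ.sup' Finset.univ_nonempty ω - x₀| ≤ ε}
      ≤ ENNReal.ofReal ((Real.sqrt (2 * Real.log n) + 4) * (2 * ε))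
        * (Measure.pi fun _ : Fin n => gaussianReal 0 1) univ := by
  have hset : {ω : Fin n → ℝ | |Finset.univ.sup' Finset.univ_nonempty ω - x₀| ≤ ε}
      = (fun ω : Fin n → ℝ => Finset.univ.sup' Finset.univ_nonempty ω) ⁻¹' Icc (x₀ - ε) (x₀ + ε) := by
    ext ω
    simp only [mem_setOf_eq, mem_preimage, mem_Icc, abs_sub_le_iff]
    constructor <;> rintro ⟨h1, h2⟩ <;> constructor <;> linarith
  rw [hset, measure_univ, mul_one, ← Measure.map_apply measurable_sup' measurableSet_Icc]
  have h := densityBound_map_sup'_pi_gaussianReal (n := n) (x₀ - ε) (x₀ + ε) (by linarith)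
  refine h.trans (le_of_eq ?_)
  congr 1
  ring

/-- **(M1) FOR A GAUSSIAN-MAX SLOT VARIABLE**: `SlotAntiConcentration μ max θ ρ ((√(2 log n) + 4)·θ)` for `θ, ρ ≥ 0` —
the shell `{θ(1 − ρ) ≤ max < θ}` lies in `[θ(1 − ρ), θ]`, of length `θρ`. [textbook] -/
theorem slotAntiConcentration_sup'_pi_gaussianReal {θ ρ : ℝ} (hθ : 0 ≤ θ) (hρ : 0 ≤ ρ) :
    Literature.MathematicalPhysics.QuantumFieldTheory.Balaban1983to89.T4ShellMeasure.SlotAntiConcentration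
      (Measure.pi fun _ : Fin n => gaussianReal 0 1)
      (fun ω : Fin n → ℝ => Finset.univ.sup' Finset.univ_nonempty ω) θ ρ ((Real.sqrt (2 * Real.log n) + 4) * θ) := by
  unfold Literature.MathematicalPhysics.QuantumFieldTheory.Balaban1983to89.T4ShellMeasure.SlotAntiConcentration
  have hsub : {ω : Fin n → ℝ | θ * (1 - ρ) ≤ Finset.univ.sup' Finset.univ_nonempty ω ∧ Finset.univ.sup' Finset.univ_nonempty ω < θ}
      ⊆ (fun ω : Fin n → ℝ => Finset.univ.sup' Finset.univ_nonempty ω) ⁻¹' Icc (θ * (1 - ρ)) θ := by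
    intro ω hω
    simp only [mem_setOf_eq, mem_preimage, mem_Icc] at hω ⊢
    exact ⟨hω.1, hω.2.le⟩
  rw [measure_univ, mul_one]
  refine (measure_mono hsub).trans ?_
  rw [← Measure.map_apply measurable_sup' measurableSet_Icc]
  have h := densityBound_map_sup'_pi_gaussianReal (n := n) (θ * (1 - ρ)) θ (by nlinarith)
  refine h.trans (le_of_eq ?_)
  congr 1
  ring

/-! ## §5 Truncation at the slot's own threshold (lens KT-36a in the comparison model): conditioning on the small-field
event `{max < θ}` costs the factor `P(max < θ)⁻¹ ≤ 2` whenever `n·(1 − Φ(θ)) ≤ ½` -/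

/-- restriction to an event of at least `1/c` of the mass keeps (M1) with constant `c·D` (the shell mass does not grow,
the normalising mass shrinks by at most `c`). [folklore] -/
theorem slotAntiConcentration_restrict_of_mass {Ω : Type*} [MeasurableSpace Ω] {μ : Measure Ω} {u : Ω → ℝ}
    {θ ρ D c : ℝ} (hD : 0 ≤ D) (hρ : 0 ≤ ρ)
    (h : Literature.MathematicalPhysics.QuantumFieldTheory.Balaban1983to89.T4ShellMeasure.SlotAntiConcentration μ u θ ρ D)
    {E : Set Ω} (hE : μ univ ≤ ENNReal.ofReal c * μ E) :
    Literature.MathematicalPhysics.QuantumFieldTheory.Balaban1983to89.T4ShellMeasure.SlotAntiConcentration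
      (μ.restrict E) u θ ρ (c * D) := by
  unfold Literature.MathematicalPhysics.QuantumFieldTheory.Balaban1983to89.T4ShellMeasure.SlotAntiConcentration at h ⊢
  rw [Measure.restrict_apply_univ]
  calc μ.restrict E {x | θ * (1 - ρ) ≤ u x ∧ u x < θ}
      ≤ μ {x | θ * (1 - ρ) ≤ u x ∧ u x < θ} := Measure.restrict_le_self _
    _ ≤ ENNReal.ofReal (D * ρ) * μ univ := h
    _ ≤ ENNReal.ofReal (D * ρ) * (ENNReal.ofReal c * μ E) := mul_le_mul' le_rfl hE
    _ = ENNReal.ofReal (c * D * ρ) * μ E := by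
        rw [← mul_assoc, ← ENNReal.ofReal_mul (by positivity)]
        congr 2
        ring

/-- the law of the maximum has NO ATOMS (an interval of length `0` has mass `≤ (√(2 log n) + 4)·0`). [textbook] -/
theorem pi_gaussianReal_sup'_eq_null (z : ℝ) :
    (Measure.pi fun _ : Fin n => gaussianReal 0 1) {ω : Fin n → ℝ | Finset.univ.sup' Finset.univ_nonempty ω = z} = 0 := by
  have h := densityBound_map_sup'_pi_gaussianReal (n := n) z z le_rfl
  rw [Measure.map_apply measurable_sup' measurableSet_Icc, sub_self, mul_zero, ENNReal.ofReal_zero] at h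
  have hset : {ω : Fin n → ℝ | Finset.univ.sup' Finset.univ_nonempty ω = z}
      = (fun ω : Fin n → ℝ => Finset.univ.sup' Finset.univ_nonempty ω) ⁻¹' Icc z z := by
    ext ω; simp
  rw [hset]
  exact le_antisymm h bot_le

/-- `P(max < θ) = Φ(θ)^n` (the strict event; no atoms). [textbook] -/
theorem pi_gaussianReal_real_sup'_lt (θ : ℝ) :
    (Measure.pi fun _ : Fin n => gaussianReal 0 1).real
        {ω : Fin n → ℝ | Finset.univ.sup' Finset.univ_nonempty ω < θ}
      = cdf (gaussianReal 0 1) θ ^ n := by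
  rw [← pi_gaussianReal_real_sup'_le θ]
  refine measureReal_congr ?_
  have hle : {ω : Fin n → ℝ | Finset.univ.sup' Finset.univ_nonempty ω ≤ θ}
      = {ω : Fin n → ℝ | Finset.univ.sup' Finset.univ_nonempty ω < θ}
        ∪ {ω : Fin n → ℝ | Finset.univ.sup' Finset.univ_nonempty ω = θ} := by
    ext ω
    simp only [mem_setOf_eq, mem_union]
    exact le_iff_lt_or_eq
  rw [hle]
  exact (union_ae_eq_left_of_ae_eq_empty ((ae_eq_empty).2 (pi_gaussianReal_sup'_eq_null θ))).symm

omit [NeZero n] in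
/-- the small-field event `{max < θ}` carries at least half the mass once `n·(1 − Φ(θ)) ≤ ½` (Bernoulli ∕ union bound:
`Φ(θ)^n ≥ 1 − n(1 − Φ(θ))`). [textbook] -/
theorem half_le_cdf_pow {θ : ℝ} (hθ : (n : ℝ) * (1 - cdf (gaussianReal 0 1) θ) ≤ 1 / 2) :
    1 / 2 ≤ cdf (gaussianReal 0 1) θ ^ n := by
  have hΦ1 : cdf (gaussianReal 0 1) θ ≤ 1 := cdf_le_one _ _
  have hb : 1 + (n : ℝ) * (-(1 - cdf (gaussianReal 0 1) θ)) ≤ (1 + -(1 - cdf (gaussianReal 0 1) θ)) ^ n :=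
    one_add_mul_le_pow (by linarith [cdf_nonneg (gaussianReal 0 1) θ]) n
  have : (1 + -(1 - cdf (gaussianReal 0 1) θ)) = cdf (gaussianReal 0 1) θ := by ring
  rw [this] at hb
  linarith

/-- **(M1) UNDER TRUNCATION AT THE SLOT'S OWN THRESHOLD** (lens KT-36a, comparison model): for `θ, ρ ≥ 0` with
`n·(1 − Φ(θ)) ≤ ½` — the regime where the union bound already makes the block's large-field event rare — the law of
the `n` independent standard Gaussians CONDITIONED on the small-field event `{max < θ}` satisfies
`SlotAntiConcentration (μ|{max < θ}) max θ ρ (2(√(2 log n) + 4)·θ)`: no log-concavity or truncated-Gaussian comparison is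
needed in the iid model, only `P(max < θ) ≥ ½`. [textbook] -/
theorem slotAntiConcentration_restrict_smallField_pi_gaussianReal {θ ρ : ℝ} (hθ : 0 ≤ θ) (hρ : 0 ≤ ρ)
    (hsmall : (n : ℝ) * (1 - cdf (gaussianReal 0 1) θ) ≤ 1 / 2) :
    Literature.MathematicalPhysics.QuantumFieldTheory.Balaban1983to89.T4ShellMeasure.SlotAntiConcentration
      ((Measure.pi fun _ : Fin n => gaussianReal 0 1).restrict
        {ω : Fin n → ℝ | Finset.univ.sup' Finset.univ_nonempty ω < θ})
      (fun ω : Fin n → ℝ => Finset.univ.sup' Finset.univ_nonempty ω) θ ρ (2 * ((Real.sqrt (2 * Real.log n) + 4) * θ)) := by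
  set μ := (Measure.pi fun _ : Fin n => gaussianReal 0 1) with hμ
  refine slotAntiConcentration_restrict_of_mass (by positivity) hρ
    (slotAntiConcentration_sup'_pi_gaussianReal hθ hρ) ?_
  -- μ univ = 1 ≤ 2 · Φ(θ)^n = 2 · μ {max < θ}
  have hhalf := half_le_cdf_pow (n := n) hsmall
  have hE : μ {ω : Fin n → ℝ | Finset.univ.sup' Finset.univ_nonempty ω < θ} = ENNReal.ofReal (cdf (gaussianReal 0 1) θ ^ n) := by
    rw [← pi_gaussianReal_real_sup'_lt θ, measureReal_def, ENNReal.ofReal_toReal (measure_ne_top _ _)]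
  rw [measure_univ, hE, ← ENNReal.ofReal_mul (by norm_num), ← ENNReal.ofReal_one]
  exact ENNReal.ofReal_le_ofReal (by linarith)

end Max

end Summit.QuantumFields.YangMills.Theorems.N21GaussianSupDensityBound
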